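import Summits.QuantumFields.YangMills.Theorems.SwapVirialDeficitBlowUpPointwise
import HarnessLib

/-!
# The massive-mode rung at fixed `L`, brick J5-G: the MEASURABLE LIMIT FUNCTIONAL `G` and hypothesis `(P)` of the blow-up shell, parametrically
# (fcl-p3 g45's memo `memo-24197 — the MASSIVE-MODE RUNG at fixed L` §1 (P): «Measurable `G`: take `G := liminf_n n²·F(config(x; 1/n))`»;
# free-hands support of ⟨stmt-QuantumFields-24197⟩)

✓`…BlowUpPointwise` is the one-variable calculus of (P) for ONE function `g`.  The shell ✓`BlowUp.smallBall_limit_real_of_blowUp_of_weight` wants it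
PARAMETRICALLY in the blow-up point `x ∈ B`: a MEASURABLE `G : B → ℝ`, a measurable flat set `Dom₀`, and
`∀ᵐ x, ∀ r > 0, G x ≠ r → ∀ᶠ u in 𝓝[>] 0, (x ∈ E r u ↔ (x ∈ Dom₀ ∧ G x < r))` for events of the form `E r u = {x | x ∈ S u ∧ g x (√u) ≤ r·u}`
(`S u` = the side conditions «dilated letters in the unit balls», `g x t = F(config(x; t))`).  This file does that bookkeeping once, for an ABSTRACT
family `g : B → ℝ → ℝ` — no ring, no quaternions:
* §1 ★ `blowUpLimit g x := (liminf_n ofReal((n+1)²·g x (1/(n+1))))).toReal` — MEASURABLE as soon as each `x ↦ g x (1/(n+1))` is (`measurable_blowUpLimit`;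
  no joint continuity in `x` is needed, so the degenerate null set of the charts is harmless);
* §2 ★★ `blowUpLimit_eq_of_contDiffAt` — at a flat `C²` point (`g x 0 = 0`, `0 ≤ g x` near `0`, `ContDiffAt ℝ 2 (g x) 0`) it IS `deriv (deriv (g x)) 0 / 2 ≥ 0`
  (✓`tendsto_div_sq_of_contDiffAt` along `t = 1/(n+1)`);
* §3 ★★ `eventually_mem_iff_blowUpLimit` — for a point off the boundary of the side conditions (`x ∈ S₀ → ∀ᶠ u, x ∈ S u`, `x ∉ S₀ → ∀ᶠ u, x ∉ S u`),
  `g x` continuous at `0`, `≥ 0` near `0`, and `C²` at `0` if flat: for every `r > 0` off the level `blowUpLimit g x = r`, EVENTUALLY in `u → 0⁺`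
  `(x ∈ S u ∧ g x (√u) ≤ r·u) ↔ ((x ∈ S₀ ∧ g x 0 = 0) ∧ blowUpLimit g x < r)` — the three cases flat ∕ not flat (`g x 0 > 0` beats `r·u`) ∕ outside;
* §4 ★★ `ae_shell_hP` — the `∀ᵐ` packaging: literally hypothesis `(hP)` of the shell with `Dom₀ := S₀ ∩ {x | g x 0 = 0}`, `G := blowUpLimit g`, and
  `measurableSet_dom₀`.
Deliberately NOT here: the ring's `g` (J5 proper: `F∘Ξ` along ✓`leaderTuple a (dil3 t w)` / the follower letters, `C²` by ✓`…BlowUpLetterPaths`).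
HONEST LABEL: one-variable real analysis with a measurable parameter (plumbing for a plan-level fixed-`L` rung of a DRAFT line); NOT ⟨24197⟩; own crux ⟨22884⟩
OPEN (blocked-on ⟨19935⟩); the Yang–Mills mass gap is NOT proved; no summit is proved by a line.
Width seat ym-line-sfw-p2-w3 g64 (cell ym-idea-1, free hands), `--supports stmt-QuantumFields-24197`.  One `def` (`blowUpLimit`), standard axioms, 0 `sorry`.
References: [folklore].
-/

set_option autoImplicit false

noncomputable section

open Set Filter Topology MeasureTheory
open scoped ENNReal

namespace Summit.QuantumFields.YangMills.Theorems.SwapVirialDeficit.BlowUp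

variable {B : Type*}

/-! ## §1 The measurable limit functional -/

/-- ★ **The blow-up limit functional** `G x = liminf_n (n+1)²·g x (1/(n+1))` (through `ℝ≥0∞`, so that it is measurable with no assumption beyond the
measurability of each `x ↦ g x (1/(n+1))`; at flat `C²` points it is `g″ₓ(0)/2`, §2). [folklore] -/
def blowUpLimit (g : B → ℝ → ℝ) (x : B) : ℝ :=
  (liminf (fun n : ℕ => ENNReal.ofReal (((n : ℝ) + 1) ^ 2 * g x ((n : ℝ) + 1)⁻¹)) atTop).toReal

/-- Unfolding `blowUpLimit`. [folklore] -/
theorem blowUpLimit_def (g : B → ℝ → ℝ) (x : B) :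
    blowUpLimit g x = (liminf (fun n : ℕ => ENNReal.ofReal (((n : ℝ) + 1) ^ 2 * g x ((n : ℝ) + 1)⁻¹)) atTop).toReal := rfl

/-- `blowUpLimit g x ≥ 0`. [folklore] -/
theorem blowUpLimit_nonneg (g : B → ℝ → ℝ) (x : B) : 0 ≤ blowUpLimit g x := ENNReal.toReal_nonneg

/-- ★ **`blowUpLimit g` is measurable** as soon as every section `x ↦ g x (1/(n+1))` is. [folklore] -/
theorem measurable_blowUpLimit [MeasurableSpace B] {g : B → ℝ → ℝ} (hg : ∀ n : ℕ, Measurable fun x => g x ((n : ℝ) + 1)⁻¹) :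
    Measurable (blowUpLimit g) := by
  have h : ∀ n : ℕ, Measurable fun x => ENNReal.ofReal (((n : ℝ) + 1) ^ 2 * g x ((n : ℝ) + 1)⁻¹) :=
    fun n => ENNReal.measurable_ofReal.comp ((hg n).const_mul _)
  exact (Measurable.liminf h).ennreal_toReal

/-! ## §2 Identification at flat `C²` points -/

/-- The sampling sequence `t_n = 1/(n+1) → 0` inside `{t ≠ 0}`. [folklore] -/
theorem tendsto_inv_natCast_add_one_nhdsNE : Tendsto (fun n : ℕ => ((n : ℝ) + 1)⁻¹) atTop (𝓝[≠] (0 : ℝ)) := by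
  refine tendsto_nhdsWithin_iff.2 ⟨?_, Eventually.of_forall fun n => ?_⟩
  · have h := tendsto_one_div_add_atTop_nhds_zero_nat (𝕜 := ℝ)
    simpa only [one_div] using h
  · exact inv_ne_zero (by positivity)

/-- ★★ **At a flat `C²` point the limit functional is `g″(0)/2`**: `g x 0 = 0`, `0 ≤ g x` near `0`, `ContDiffAt ℝ 2 (g x) 0` ⟹
`blowUpLimit g x = deriv (deriv (g x)) 0 / 2`, and this number is `≥ 0`. [folklore] -/
theorem blowUpLimit_eq_of_contDiffAt {g : B → ℝ → ℝ} {x : B} (h0 : g x 0 = 0) (hmin : ∀ᶠ t in 𝓝 (0 : ℝ), 0 ≤ g x t)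
    (hg : ContDiffAt ℝ 2 (g x) 0) : blowUpLimit g x = deriv (deriv (g x)) 0 / 2 ∧ 0 ≤ deriv (deriv (g x)) 0 / 2 := by
  set q : ℝ := deriv (deriv (g x)) 0 / 2 with hq
  have hT := tendsto_div_sq_of_contDiffAt hg h0 hmin
  -- along the sampling sequence
  have hseq : Tendsto (fun n : ℕ => g x (((n : ℝ) + 1)⁻¹) / (((n : ℝ) + 1)⁻¹) ^ 2) atTop (𝓝 q) := hT.comp tendsto_inv_natCast_add_one_nhdsNE
  have e : (fun n : ℕ => g x (((n : ℝ) + 1)⁻¹) / (((n : ℝ) + 1)⁻¹) ^ 2) = fun n : ℕ => ((n : ℝ) + 1) ^ 2 * g x ((n : ℝ) + 1)⁻¹ := by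
    funext n
    have hn : ((n : ℝ) + 1) ≠ 0 := by positivity
    field_simp
  rw [e] at hseq
  -- nonnegativity of the limit
  have hnn : 0 ≤ q := by
    have hev : ∀ᶠ n : ℕ in atTop, 0 ≤ ((n : ℝ) + 1) ^ 2 * g x ((n : ℝ) + 1)⁻¹ := by
      have h1 : Tendsto (fun n : ℕ => ((n : ℝ) + 1)⁻¹) atTop (𝓝 (0 : ℝ)) :=
        tendsto_nhds_of_tendsto_nhdsWithin tendsto_inv_natCast_add_one_nhdsNE
      filter_upwards [h1.eventually hmin] with n hn
      exact mul_nonneg (by positivity) hn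
    exact ge_of_tendsto hseq hev
  refine ⟨?_, hnn⟩
  have hE : Tendsto (fun n : ℕ => ENNReal.ofReal (((n : ℝ) + 1) ^ 2 * g x ((n : ℝ) + 1)⁻¹)) atTop (𝓝 (ENNReal.ofReal q)) :=
    (ENNReal.continuous_ofReal.tendsto q).comp hseq
  rw [blowUpLimit_def, hE.liminf_eq, ENNReal.toReal_ofReal hnn]

/-! ## §3 Hypothesis (P) at one point -/

/-- If `g x 0 > 0` and `g x` is continuous at `0`, then EVENTUALLY `r·u < g x (√u)`: a non-flat point leaves every blown-up event. [folklore] -/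
theorem eventually_lt_of_pos {γ : ℝ → ℝ} (hcont : ContinuousAt γ 0) (hpos : 0 < γ 0) (r : ℝ) :
    ∀ᶠ u in 𝓝[>] (0 : ℝ), r * u < γ (Real.sqrt u) := by
  -- `γ(√u) → γ 0 > 0` while `r·u → 0`
  have h1 : Tendsto (fun u : ℝ => γ (Real.sqrt u)) (𝓝[>] (0 : ℝ)) (𝓝 (γ 0)) := by
    have hs : Tendsto Real.sqrt (𝓝[>] (0 : ℝ)) (𝓝 0) := by
      have := Real.continuous_sqrt.tendsto (0 : ℝ)
      rw [Real.sqrt_zero] at this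
      exact tendsto_nhdsWithin_of_tendsto_nhds this
    exact hcont.tendsto.comp hs
  have h2 : Tendsto (fun u : ℝ => r * u) (𝓝[>] (0 : ℝ)) (𝓝 0) := by
    have h : Tendsto (fun u : ℝ => r * u) (𝓝 0) (𝓝 (r * 0)) := tendsto_id.const_mul r
    rw [mul_zero] at h
    exact tendsto_nhdsWithin_of_tendsto_nhds h
  have h3 : ∀ᶠ u in 𝓝[>] (0 : ℝ), γ 0 / 2 < γ (Real.sqrt u) := h1.eventually (lt_mem_nhds (by linarith))
  have h4 : ∀ᶠ u in 𝓝[>] (0 : ℝ), r * u < γ 0 / 2 := h2.eventually (gt_mem_nhds (by linarith))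
  filter_upwards [h3, h4] with u a b using b.trans a

/-- ★★ **Hypothesis (P) at one point.**  Side conditions `S u` with limit set `S₀` (`x` not on the boundary: inside ⟹ eventually in `S u`, outside ⟹
eventually out), `g x` continuous at `0`, `≥ 0` near `0`, and `C²` at `0` if flat.  Then for every `r` (any sign) off the level `blowUpLimit g x = r`,
EVENTUALLY as `u → 0⁺`:
`(x ∈ S u ∧ g x (√u) ≤ r·u) ↔ ((x ∈ S₀ ∧ g x 0 = 0) ∧ blowUpLimit g x < r)`. [folklore] -/
theorem eventually_mem_iff_blowUpLimit {S : ℝ → Set B} {S₀ : Set B} {g : B → ℝ → ℝ} {x : B}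
    (hin : x ∈ S₀ → ∀ᶠ u in 𝓝[>] (0 : ℝ), x ∈ S u) (hout : x ∉ S₀ → ∀ᶠ u in 𝓝[>] (0 : ℝ), x ∉ S u)
    (hcont : ContinuousAt (g x) 0) (hmin : ∀ᶠ t in 𝓝 (0 : ℝ), 0 ≤ g x t) (hC2 : g x 0 = 0 → ContDiffAt ℝ 2 (g x) 0)
    {r : ℝ} (hGr : blowUpLimit g x ≠ r) :
    ∀ᶠ u in 𝓝[>] (0 : ℝ), (x ∈ S u ∧ g x (Real.sqrt u) ≤ r * u) ↔ ((x ∈ S₀ ∧ g x 0 = 0) ∧ blowUpLimit g x < r) := by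
  by_cases hS : x ∈ S₀
  · by_cases h0 : g x 0 = 0
    · -- flat `C²` point: Taylor
      obtain ⟨hq, -⟩ := blowUpLimit_eq_of_contDiffAt h0 hmin (hC2 h0)
      have hT : Tendsto (fun t : ℝ => g x t / t ^ 2) (𝓝[>] (0 : ℝ)) (𝓝 (blowUpLimit g x)) := by
        rw [hq]
        exact (tendsto_div_sq_of_contDiffAt (hC2 h0) h0 hmin).mono_left (nhdsWithin_mono _ fun t (ht : 0 < t) => ht.ne')
      filter_upwards [hin hS, eventually_sqrt_le_mul_iff hT hGr] with u hu he
      simp only [hu, hS, h0, true_and, and_self, he]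
    · -- not flat: `g x 0 > 0` beats `r·u`
      have hpos : 0 < g x 0 := lt_of_le_of_ne (hmin.self_of_nhds) (Ne.symm h0)
      filter_upwards [eventually_lt_of_pos hcont hpos r] with u hu
      simp only [h0, and_false, false_and, iff_false, not_and, not_le]
      exact fun _ => hu
  · -- outside the side conditions
    filter_upwards [hout hS] with u hu
    simp only [hu, hS, false_and]

/-! ## §4 The `∀ᵐ` packaging: hypotheses `(hG)`, `(hDom)`, `(hP)` of the shell -/

/-- `Dom₀ = S₀ ∩ {x | g x 0 = 0}` is measurable. [folklore] -/
theorem measurableSet_dom₀ [MeasurableSpace B] {S₀ : Set B} (hS₀ : MeasurableSet S₀) {g : B → ℝ → ℝ} (hg0 : Measurable fun x => g x 0) :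
    MeasurableSet (S₀ ∩ {x | g x 0 = 0}) :=
  hS₀.inter (hg0 (measurableSet_singleton (0 : ℝ)))

/-- ★★ **Hypothesis (P) of ✓`BlowUp.smallBall_limit_real_of_blowUp_of_weight`, almost everywhere.**  If `β`-a.e. point is off the boundary of the
side conditions, has `g x` continuous at `0`, nonnegative near `0` and `C²` at `0` when flat, then with `E r u := {x | x ∈ S u ∧ g x (√u) ≤ r·u}`,
`Dom₀ := S₀ ∩ {g · 0 = 0}` and `G := blowUpLimit g`:
`∀ᵐ x ∂β, ∀ r > 0, G x ≠ r → ∀ᶠ u in 𝓝[>] 0, (x ∈ E r u ↔ (x ∈ Dom₀ ∧ G x < r))`. [folklore] -/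
theorem ae_shell_hP [MeasurableSpace B] (β : Measure B) {S : ℝ → Set B} {S₀ : Set B} {g : B → ℝ → ℝ}
    (hbd : ∀ᵐ x ∂β, (x ∈ S₀ → ∀ᶠ u in 𝓝[>] (0 : ℝ), x ∈ S u) ∧ (x ∉ S₀ → ∀ᶠ u in 𝓝[>] (0 : ℝ), x ∉ S u))
    (hreg : ∀ᵐ x ∂β, ContinuousAt (g x) 0 ∧ (∀ᶠ t in 𝓝 (0 : ℝ), 0 ≤ g x t) ∧ (g x 0 = 0 → ContDiffAt ℝ 2 (g x) 0)) :
    ∀ᵐ x ∂β, ∀ r : ℝ, 0 < r → blowUpLimit g x ≠ r → ∀ᶠ u in 𝓝[>] (0 : ℝ),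
      (x ∈ {y | y ∈ S u ∧ g y (Real.sqrt u) ≤ r * u} ↔ (x ∈ S₀ ∩ {y | g y 0 = 0} ∧ blowUpLimit g x < r)) := by
  filter_upwards [hbd, hreg] with x hb hrg
  obtain ⟨hin, hout⟩ := hb
  obtain ⟨hcont, hmin, hC2⟩ := hrg
  intro r _ hGr
  filter_upwards [eventually_mem_iff_blowUpLimit hin hout hcont hmin hC2 hGr] with u hu
  simp only [Set.mem_setOf_eq, Set.mem_inter_iff]
  exact hu

/-- ★ On the flat part of `Dom₀` the functional is the honest second Taylor coefficient: for `β`-a.e. `x ∈ Dom₀`, `blowUpLimit g x = g″ₓ(0)/2`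
(so the limit constant of the shell is `κ·r^{−α}·β(Dom₀ ∩ {g″/2 < r})`, never needed explicitly). [folklore] -/
theorem blowUpLimit_eq_on_dom₀ {S₀ : Set B} {g : B → ℝ → ℝ} {x : B} (hx : x ∈ S₀ ∩ {y | g y 0 = 0}) (hmin : ∀ᶠ t in 𝓝 (0 : ℝ), 0 ≤ g x t)
    (hC2 : g x 0 = 0 → ContDiffAt ℝ 2 (g x) 0) : blowUpLimit g x = deriv (deriv (g x)) 0 / 2 :=
  (blowUpLimit_eq_of_contDiffAt hx.2 hmin (hC2 hx.2)).1

end Summit.QuantumFields.YangMills.Theorems.SwapVirialDeficit.BlowUp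

end
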